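import Literature.NumberTheory.EllipticCurves.Kato2004.HullDescentSkeletonProofs
import Literature.NumberTheory.EllipticCurves.IwasawaAlgebraPseudoNullProofs
import Literature.NumberTheory.EllipticCurves.IwasawaAlgebraDivisibilityProofs
import HarnessLib

/-!
# Kato's §14.14–14.15 descent THROUGH THE REFLEXIVE HULL — the EXACT index and the equality case
# (module theory over `Λ = ℤ_p⟦T⟧`; companion of `HullDescentSkeletonProofs`; theorems only)

`HullDescentSkeletonProofs` (cell `bsd-potss`, seat `kmc`, part 11) runs Kato's §14.14–14.15 count at a
lattice whose zeta element `z` is only known to lie in the reflexive hull `j : H ↪ F` of `H = 𝐇¹(T)⁰`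
(`y = p^e z ∈ H`), and proves `[A : Λ·ι(ȳ)] = p^{e+m} · #(H2/TH2)` for some `m ≥ 0` GRANTED the
divisibility `ℓ_𝔮(H2) ≤ ℓ_𝔮(F/Λz)` at every height-one prime `𝔮` (Kato Thm. 12.5 (3)–(4) / Wuthrich
2014 Lemma 14). This file isolates the UNCONDITIONAL identity behind it and adds the two equality
statements that the descent of the Main Conjecture itself needs:

* `index_eq_natCard_invariants_mul_pow_of_hull` — with NO divisibility hypothesis:
  **`[A : Λ·ι(ȳ)] = #H2[T] · p^{e(F/Λz) + e}`** (`e(·)` the `Γ`-Euler exponent of Lemma 14.15), once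
  `[A : Λ·ι(ȳ)] ≠ 0`; together with `#(H2/TH2) = #H2[T] · p^{e(H2)}` this says that Kato's
  `μ = [A : z]/#H²(ℤ[1/p],T)` (p. 244) equals `p^{e(F/Λz) − e(H2)}` exactly
  (`padicValNat_index_eq_of_hull`).
* `index_eq_pow_mul_natCard_coinvariants_of_hull_of_lengthAt_eq` — **Conj. 12.10 read on the hull**
  (`ℓ_𝔮(H2) = ℓ_𝔮(F/Λz)` at every height-one `𝔮`) **⇒ `[A : Λ·ι(ȳ)] = p^e · #(H2/TH2)`**, i.e. `μ = 1`
  (Kato §14.14–14.15 run with 12.10, at a lattice whose zeta element is only in the hull — the case of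
  a member of the isogeny class WITH rational `p`-torsion, Wuthrich 2014 §3.2–3.4).
* `lengthAt_eq_of_index_eq_pow_mul_natCard_coinvariants_of_hull` — the converse: the divisibility at
  every height-one prime and `μ = 1` give the equality at every height-one prime (the termwise
  inequalities with equal weighted sums are equalities; at `𝔮 = (T)` both sides vanish).

Module theory only: nothing about Kato's objects `𝐇^q(T)`, `z_γ`, `H^q(ℤ[1/p],T)` is asserted; the
dictionary is in the docstrings (`F = 𝐇¹(T)^{**}`, `H = 𝐇¹(T)`, `H2 = 𝐇²(T)`, `A = H¹(ℤ[1/p],T)`,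
(14.14.1) `0 → H/TH →ι A →π H2[T] → 0`). Consumer: `Summits/BirchSwinnertonDyer/Rank1Residual/O6/
X3KatoMemberBoundExactCount.lean` (the exact rank-`0` count at an arbitrary member of the isogeny
class and `KMC ⟺ BSD_p` there).

References: [Kato2004Asterisque] Thm. 12.4 (p. 221), Thm. 12.5 (3)–(4), Thm. 12.6 (p. 222), Conj. 12.10
(p. 224), 13.14 (p. 234), Thm. 14.5 and the index `[M : z]` (pp. 236–237), §14.14 (14.14.1)–(14.14.2)
and Lemma 14.15 (pp. 243–244), Prop. 14.16 (2) (p. 244); [Wuthrich2014] §3.2–3.4 (pp. 394–396);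
the `Γ`-Euler characteristic: [GreenbergLNM1716] §4 Lemma 4.2, [Washington1997] §13.2.
-/

noncomputable section

open scoped Classical

universe u

namespace Literature.NumberTheory.EllipticCurves.Kato2004

open Literature.NumberTheory.EllipticCurves.IwasawaAlgebra

variable {p : ℕ} [Fact p.Prime]

/-! ### §1 Termwise equality from the inequality and equal Euler exponents -/

section Termwise

variable {M N : Type u} [AddCommGroup M] [Module (IwasawaAlgebra p) M]
  [AddCommGroup N] [Module (IwasawaAlgebra p) N]
  [Module.Finite (IwasawaAlgebra p) M] [Module.Finite (IwasawaAlgebra p) N]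

/-- **Termwise equality.** For finitely generated torsion `Λ`-modules `M`, `N` with
`ℓ_𝔮(M) ≤ ℓ_𝔮(N)` at every height-one prime `𝔮`, equal `Γ`-Euler exponents `e(M) = e(N)` and equal
lengths at `𝔮 = (T)`: `ℓ_𝔮(M) = ℓ_𝔮(N)` at EVERY height-one `𝔮` — the weighted sums
`Σ_{𝔮 ≠ (T)} ℓ_𝔮 · v_p(q_𝔮(0))` agree, the weights are `≥ 1` (`one_le_constVal`), so the termwise
inequalities are equalities. (The step "μ = 1 and Thm. 12.5 (4) give Conj. 12.10" of the converse
descent, abstracted from `lengthAt_eq_of_index_zeta_eq_natCard_coinvariants`.)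
[cite: Kato2004Asterisque, Thm. 12.5 (4) (p. 222), Conj. 12.10 (p. 224), Lemma 14.15 (p. 244)] -/
theorem lengthAt_eq_of_lengthAt_le_of_eulerExp_eq (hM : Module.IsTorsion (IwasawaAlgebra p) M)
    (hN : Module.IsTorsion (IwasawaAlgebra p) N)
    (hle : ∀ 𝔮 : PrimeSpectrum (IwasawaAlgebra p), 𝔮.asIdeal.height = 1 →
      Module.lengthAt (IwasawaAlgebra p) M 𝔮 ≤ Module.lengthAt (IwasawaAlgebra p) N 𝔮)
    (he : eulerExp p M = eulerExp p N)
    (hT : Module.lengthAt (IwasawaAlgebra p) M (primeT p) =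
      Module.lengthAt (IwasawaAlgebra p) N (primeT p)) :
    ∀ 𝔮 : PrimeSpectrum (IwasawaAlgebra p), 𝔮.asIdeal.height = 1 →
      Module.lengthAt (IwasawaAlgebra p) M 𝔮 = Module.lengthAt (IwasawaAlgebra p) N 𝔮 := by
  intro 𝔮 h𝔮
  by_cases hqT : 𝔮 = primeT p
  · rw [hqT, hT]
  have hmem : 𝔮 ∈ heightOneNeT p := ⟨h𝔮, hqT⟩
  -- reduce the finsums to a common finite set
  have hSM := finite_heightOneNeT_inter_support M hM
  have hSN := finite_heightOneNeT_inter_support N hN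
  set S : Finset (PrimeSpectrum (IwasawaAlgebra p)) := (hSM.union hSN).toFinset with hS
  have hsubM : heightOneNeT p ∩ Function.support (fun 𝔮 ↦
      (Module.lengthAt (IwasawaAlgebra p) M 𝔮).toNat * constVal p 𝔮) ⊆ S := by
    intro x hx; rw [hS, Set.Finite.coe_toFinset]; exact Or.inl hx
  have hsubN : heightOneNeT p ∩ Function.support (fun 𝔮 ↦
      (Module.lengthAt (IwasawaAlgebra p) N 𝔮).toNat * constVal p 𝔮) ⊆ S := by
    intro x hx; rw [hS, Set.Finite.coe_toFinset]; exact Or.inr hx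
  have hSsub : (S : Set (PrimeSpectrum (IwasawaAlgebra p))) ⊆ heightOneNeT p := by
    intro x hx
    rw [hS, Set.Finite.coe_toFinset] at hx
    rcases hx with hx | hx <;> exact hx.1
  have eM : eulerExp p M = ∑ 𝔮 ∈ S, (Module.lengthAt (IwasawaAlgebra p) M 𝔮).toNat * constVal p 𝔮 :=
    finsum_mem_eq_sum_of_subset _ hsubM hSsub
  have eN : eulerExp p N = ∑ 𝔮 ∈ S, (Module.lengthAt (IwasawaAlgebra p) N 𝔮).toNat * constVal p 𝔮 :=
    finsum_mem_eq_sum_of_subset _ hsubN hSsub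
  have hleS : ∀ i ∈ S, (Module.lengthAt (IwasawaAlgebra p) M i).toNat * constVal p i ≤
      (Module.lengthAt (IwasawaAlgebra p) N i).toNat * constVal p i := by
    intro i hi
    have hi' := hSsub (Finset.mem_coe.mpr hi)
    exact Nat.mul_le_mul_right _ (ENat.toNat_le_toNat (hle i hi'.1)
      (IwasawaAlgebra.lengthAt_ne_top_of_isTorsion N hN i (le_of_eq hi'.1)))
  have hsum : ∑ i ∈ S, (Module.lengthAt (IwasawaAlgebra p) M i).toNat * constVal p i =
      ∑ i ∈ S, (Module.lengthAt (IwasawaAlgebra p) N i).toNat * constVal p i := by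
    rw [← eM, ← eN, he]
  have hterm := (Finset.sum_eq_sum_iff_of_le hleS).mp hsum
  have hfinM := IwasawaAlgebra.lengthAt_ne_top_of_isTorsion M hM 𝔮 (le_of_eq h𝔮)
  have hfinN := IwasawaAlgebra.lengthAt_ne_top_of_isTorsion N hN 𝔮 (le_of_eq h𝔮)
  by_cases h𝔮S : 𝔮 ∈ S
  · have h := hterm 𝔮 h𝔮S
    have hc : 0 < constVal p 𝔮 := one_le_constVal hmem
    have h' := Nat.eq_of_mul_eq_mul_right hc h
    rw [← ENat.coe_toNat hfinM, ← ENat.coe_toNat hfinN, h']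
  · -- outside `S` both weighted lengths vanish, and the weight is positive
    have hc : 0 < constVal p 𝔮 := one_le_constVal hmem
    have hM0 : (Module.lengthAt (IwasawaAlgebra p) M 𝔮).toNat * constVal p 𝔮 = 0 := by
      by_contra h0
      exact h𝔮S (hsubM ⟨hmem, Function.mem_support.mpr h0⟩)
    have hN0 : (Module.lengthAt (IwasawaAlgebra p) N 𝔮).toNat * constVal p 𝔮 = 0 := by
      by_contra h0
      exact h𝔮S (hsubN ⟨hmem, Function.mem_support.mpr h0⟩)
    have hM0' : (Module.lengthAt (IwasawaAlgebra p) M 𝔮).toNat = 0 := by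
      rcases Nat.mul_eq_zero.mp hM0 with h | h
      · exact h
      · exact absurd h hc.ne'
    have hN0' : (Module.lengthAt (IwasawaAlgebra p) N 𝔮).toNat = 0 := by
      rcases Nat.mul_eq_zero.mp hN0 with h | h
      · exact h
      · exact absurd h hc.ne'
    rw [← ENat.coe_toNat hfinM, ← ENat.coe_toNat hfinN, hM0', hN0']

end Termwise

/-! ### §2 The exact index through the hull -/

section Hull

variable {F H H2 A : Type u} [AddCommGroup F] [Module (IwasawaAlgebra p) F]
  [AddCommGroup H] [Module (IwasawaAlgebra p) H] [AddCommGroup H2] [Module (IwasawaAlgebra p) H2]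
  [AddCommGroup A] [Module (IwasawaAlgebra p) A]
  [Module.Finite (IwasawaAlgebra p) F] [NoZeroSMulDivisors (IwasawaAlgebra p) F]
  [Module.Finite (IwasawaAlgebra p) H] [NoZeroSMulDivisors (IwasawaAlgebra p) H]
  [Module.Finite (IwasawaAlgebra p) H2]

omit [Module.Finite (IwasawaAlgebra p) F] [NoZeroSMulDivisors (IwasawaAlgebra p) F] in
/-- `F/Λ(c·z)` is torsion when `F/Λz` is and `c ≠ 0`. [folklore] -/
private theorem isTorsion_quotient_span_smul_of_ne_zero {c : IwasawaAlgebra p} (hc : c ≠ 0) (z : F)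
    (hFZ : Module.IsTorsion (IwasawaAlgebra p) (F ⧸ (IwasawaAlgebra p) ∙ z)) :
    Module.IsTorsion (IwasawaAlgebra p) (F ⧸ (IwasawaAlgebra p) ∙ (c • z)) := by
  intro q
  induction q using Submodule.Quotient.induction_on with
  | H x =>
    obtain ⟨a, ha⟩ := @hFZ (Submodule.Quotient.mk x)
    rw [Submonoid.smul_def, ← Submodule.Quotient.mk_smul, Submodule.Quotient.mk_eq_zero,
      Submodule.mem_span_singleton] at ha
    obtain ⟨b, hb⟩ := ha
    refine ⟨⟨c * (a : IwasawaAlgebra p),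
      mul_mem (mem_nonZeroDivisors_of_ne_zero hc) a.2⟩, ?_⟩
    rw [Submonoid.smul_def]
    change (c * (a : IwasawaAlgebra p)) • Submodule.Quotient.mk x = 0
    rw [← Submodule.Quotient.mk_smul, Submodule.Quotient.mk_eq_zero, Submodule.mem_span_singleton]
    exact ⟨b, by rw [mul_smul, ← hb, smul_comm]⟩

omit [Module.Finite (IwasawaAlgebra p) H2] in
/-- **THE EXACT INDEX THROUGH THE HULL (Kato §14.14–14.15, no Main-Conjecture input).** Over
`Λ = ℤ_p⟦T⟧`: `F` finitely generated torsion free (`𝐇¹(T)^{**}`), `j : H ↪ F` of finite index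
(`H = 𝐇¹(T)`, Thm. 12.4 (2)), `z ∈ F` non-zero with `F/Λz` torsion (the zeta element in the hull,
Thm. 12.6 + 13.14), `H2` finitely generated torsion (`𝐇²(T)`, Thm. 12.4 (1)), `0 → H/TH →ι A →π H2[T] → 0`
exact ((14.14.1)), `H2/TH2` finite ((14.14.2), Thm. 14.5 (1)), `y ∈ H` with `j(y) = p^e·z`, and
`[A : Λ·ι(ȳ)] ≠ 0`. Then **`[A : Λ·ι(ȳ)] = #H2[T] · p^{e(F/Λz) + e}`**: `[A : Λ·ι ȳ] = #H2[T]·#((H/Λy)/T)`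
(exactness), `(H/Λy)[T] = 0` so `#((H/Λy)/T) = p^{e(H/Λy)}` (Lemma 14.15), `e(H/Λy) = e(F/Λ j(y))`
(the hull index is pseudo-null), `e(F/Λ p^e z) = e(F/Λz) + e(Λ/(p^e)) = e(F/Λz) + e`. No divisibility
is used: this is the identity from which both Thm. 14.5 (3) (`μ ≥ 1` under 12.5 (4)) and the descent of
Conj. 12.10 (`μ = 1`) follow. [cite: Kato2004Asterisque, §14.14 (14.14.1)–(14.14.2) and Lemma 14.15 (pp. 243–244), 13.14 (p. 234), `[M : z]` (pp. 236–237)] -/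
theorem index_eq_natCard_invariants_mul_pow_of_hull (j : H →ₗ[IwasawaAlgebra p] F)
    (hj : Function.Injective j) (hcok : Finite (F ⧸ LinearMap.range j)) (z : F) (hz : z ≠ 0)
    (hFZ : Module.IsTorsion (IwasawaAlgebra p) (F ⧸ (IwasawaAlgebra p) ∙ z))
    (y : H) (e : ℕ) (hy : j y = PowerSeries.C ((p : ℤ_[p]) ^ e) • z)
    (ι : coinvariants p H →ₗ[IwasawaAlgebra p] A) (π : A →ₗ[IwasawaAlgebra p] invariants p H2)
    (hι : Function.Injective ι) (hπ : Function.Surjective π) (hex : Function.Exact ι π)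
    (hne : Nat.card (A ⧸ (IwasawaAlgebra p) ∙ ι (Submodule.Quotient.mk y)) ≠ 0) :
    Nat.card (A ⧸ (IwasawaAlgebra p) ∙ ι (Submodule.Quotient.mk y)) =
      Nat.card (invariants p H2) * p ^ (eulerExp p (F ⧸ (IwasawaAlgebra p) ∙ z) + e) := by
  have hp0 : (p : ℤ_[p]) ≠ 0 := by exact_mod_cast (Fact.out : p.Prime).ne_zero
  have hc : PowerSeries.C ((p : ℤ_[p]) ^ e) ≠ (0 : IwasawaAlgebra p) := by
    rw [Ne, ← map_zero (PowerSeries.C (R := ℤ_[p])), PowerSeries.C_injective.eq_iff]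
    exact pow_ne_zero _ hp0
  have hy0 : y ≠ 0 := by
    rintro rfl
    rw [map_zero] at hy
    rcases smul_eq_zero.mp hy.symm with h | h
    · exact hc h
    · exact hz h
  have hFcz : Module.IsTorsion (IwasawaAlgebra p)
      (F ⧸ (IwasawaAlgebra p) ∙ (PowerSeries.C ((p : ℤ_[p]) ^ e) • z)) :=
    isTorsion_quotient_span_smul_of_ne_zero hc z hFZ
  have hFy : Module.IsTorsion (IwasawaAlgebra p) (F ⧸ (IwasawaAlgebra p) ∙ j y) := by
    rw [hy]; exact hFcz
  obtain ⟨hHy, heHF⟩ := eulerExp_quotient_span_eq_of_finite_index j hj hcok y hFy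
  have heF : eulerExp p (F ⧸ (IwasawaAlgebra p) ∙ j y) =
      eulerExp p (F ⧸ (IwasawaAlgebra p) ∙ z) + e := by
    rw [hy, eulerExp_quotient_span_smul hc z hz hFZ, eulerExp_quotient_C_pow]
  set Q := H ⧸ (IwasawaAlgebra p) ∙ y with hQ
  have hA : Nat.card (A ⧸ (IwasawaAlgebra p) ∙ ι (Submodule.Quotient.mk y)) =
      Nat.card (invariants p H2) * Nat.card (coinvariants p Q) := by
    rw [natCard_quotient_eq_of_exact ι π hι hπ hex, ← natCard_coinvariants_quotient_span y]
  have hneQ : Nat.card (coinvariants p Q) ≠ 0 := by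
    intro h0
    rw [h0, mul_zero] at hA
    exact hne hA
  have hfinQ : Finite (coinvariants p Q) := Nat.finite_of_card_ne_zero hneQ
  have hTQ : Module.lengthAt (IwasawaAlgebra p) Q (primeT p) = 0 :=
    lengthAt_primeT_eq_zero_of_finite_coinvariants Q hHy hfinQ
  obtain ⟨hfinQT, -, hcardQ⟩ := card_coinvariants_of_lengthAt_eq_zero Q hHy hTQ
  rw [natCard_invariants_quotient_span_eq_one y hy0 hfinQT, one_mul] at hcardQ
  rw [hA, hcardQ, heHF, heF]

omit [NoZeroSMulDivisors (IwasawaAlgebra p) F] [NoZeroSMulDivisors (IwasawaAlgebra p) H]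
    [Module.Finite (IwasawaAlgebra p) H2] in
/-- **`ℓ_{(T)}(F/Λz) = 0` when the zeta element survives at the bottom layer** (`[A : Λ·ι(ȳ)] ≠ 0`):
`(H/Λy)/T` is then finite, `H/Λy ↪ F/Λ j(y)` has finite cokernel (a quotient of `F/j(H)`), so
`ℓ_{(T)}(F/Λ j y) = 0`, and `F/Λz` is a quotient of `F/Λ j(y)` (`j y = p^e z ∈ Λz`). Module theory only.
[cite: Kato2004Asterisque, §14.14 (14.14.1) and Lemma 14.15 (pp. 243–244), Thm. 14.5 (1)–(2) (p. 236)] -/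
theorem lengthAt_primeT_quotient_span_eq_zero_of_hull (j : H →ₗ[IwasawaAlgebra p] F)
    (hj : Function.Injective j) (hcok : Finite (F ⧸ LinearMap.range j)) (z : F)
    (hFZ : Module.IsTorsion (IwasawaAlgebra p) (F ⧸ (IwasawaAlgebra p) ∙ z))
    (y : H) (e : ℕ) (hy : j y = PowerSeries.C ((p : ℤ_[p]) ^ e) • z)
    (ι : coinvariants p H →ₗ[IwasawaAlgebra p] A) (π : A →ₗ[IwasawaAlgebra p] invariants p H2)
    (hι : Function.Injective ι) (hπ : Function.Surjective π) (hex : Function.Exact ι π)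
    (hne : Nat.card (A ⧸ (IwasawaAlgebra p) ∙ ι (Submodule.Quotient.mk y)) ≠ 0) :
    Module.lengthAt (IwasawaAlgebra p) (F ⧸ (IwasawaAlgebra p) ∙ z) (primeT p) = 0 := by
  have hp0 : (p : ℤ_[p]) ≠ 0 := by exact_mod_cast (Fact.out : p.Prime).ne_zero
  have hc : PowerSeries.C ((p : ℤ_[p]) ^ e) ≠ (0 : IwasawaAlgebra p) := by
    rw [Ne, ← map_zero (PowerSeries.C (R := ℤ_[p])), PowerSeries.C_injective.eq_iff]
    exact pow_ne_zero _ hp0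
  have hFy : Module.IsTorsion (IwasawaAlgebra p) (F ⧸ (IwasawaAlgebra p) ∙ j y) := by
    rw [hy]; exact isTorsion_quotient_span_smul_of_ne_zero hc z hFZ
  -- the induced map `θ : H/Λy → F/Λ j(y)` and its finite cokernel (as in part 11)
  set Y : Submodule (IwasawaAlgebra p) H := (IwasawaAlgebra p) ∙ y with hY
  set W : Submodule (IwasawaAlgebra p) F := (IwasawaAlgebra p) ∙ j y with hW
  have hmap : Y.map j = W := by rw [hY, hW, Submodule.map_span, Set.image_singleton]
  have hcomap : Y ≤ W.comap j := by rw [← hmap]; exact Submodule.le_comap_map _ _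
  set θ : (H ⧸ Y) →ₗ[IwasawaAlgebra p] F ⧸ W := Submodule.mapQ Y W j hcomap with hθ
  have hθ_inj : Function.Injective θ := by
    rw [← LinearMap.ker_eq_bot, hθ, Submodule.mapQ, Submodule.ker_liftQ, LinearMap.ker_comp,
      Submodule.ker_mkQ, ← hmap, Submodule.comap_map_eq, LinearMap.ker_eq_bot.mpr hj, sup_bot_eq,
      Submodule.mkQ_map_self]
  set C := (F ⧸ W) ⧸ LinearMap.range θ with hC
  have hsurj : Function.Surjective
      ((LinearMap.range j).liftQ ((LinearMap.range θ).mkQ.comp W.mkQ) (by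
        rintro _ ⟨h, rfl⟩
        rw [LinearMap.mem_ker, LinearMap.comp_apply, Submodule.mkQ_apply, Submodule.mkQ_apply,
          Submodule.Quotient.mk_eq_zero]
        exact ⟨Submodule.Quotient.mk h, by rw [hθ, Submodule.mapQ_apply]⟩)) := by
    intro q
    obtain ⟨q', rfl⟩ := Submodule.Quotient.mk_surjective _ q
    obtain ⟨x, rfl⟩ := Submodule.Quotient.mk_surjective _ q'
    exact ⟨Submodule.Quotient.mk x, rfl⟩
  haveI hCfin : Finite C := Finite.of_surjective _ hsurj
  have hexθ : Function.Exact θ (LinearMap.range θ).mkQ := LinearMap.exact_map_mkQ_range θ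
  -- `(H/Λy)/T` is finite, hence `ℓ_{(T)}(H/Λy) = 0`
  obtain ⟨hHy, -⟩ := eulerExp_quotient_span_eq_of_finite_index j hj hcok y hFy
  have hAQ : Nat.card (A ⧸ (IwasawaAlgebra p) ∙ ι (Submodule.Quotient.mk y)) =
      Nat.card (invariants p H2) * Nat.card (coinvariants p (H ⧸ Y)) := by
    rw [natCard_quotient_eq_of_exact ι π hι hπ hex, ← natCard_coinvariants_quotient_span y]
  have hneQ : Nat.card (coinvariants p (H ⧸ Y)) ≠ 0 := by
    intro h0
    rw [h0, mul_zero] at hAQ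
    exact hne hAQ
  have hfinQ : Finite (coinvariants p (H ⧸ Y)) := Nat.finite_of_card_ne_zero hneQ
  have hTQ : Module.lengthAt (IwasawaAlgebra p) (H ⧸ Y) (primeT p) = 0 :=
    lengthAt_primeT_eq_zero_of_finite_coinvariants (H ⧸ Y) hHy hfinQ
  -- `ℓ_{(T)}(C) = 0` (finite modules are pseudo-null)
  have hTC : Module.lengthAt (IwasawaAlgebra p) C (primeT p) = 0 := by
    rw [Module.lengthAt_eq_zero_iff]
    exact isPseudoNull_of_finite p C (primeT p) (le_of_eq (height_primeT p))
  -- `ℓ_{(T)}(F/Λ j y) = ℓ_{(T)}(H/Λ y) + ℓ_{(T)}(C) = 0`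
  have hTW : Module.lengthAt (IwasawaAlgebra p) (F ⧸ W) (primeT p) = 0 := by
    rw [Module.lengthAt_eq_add_of_exact θ (LinearMap.range θ).mkQ hθ_inj
      (Submodule.mkQ_surjective _) hexθ (primeT p), hTQ, hTC, add_zero]
  -- `F/Λz` is a quotient of `F/Λ j y`
  have hle : W ≤ (IwasawaAlgebra p) ∙ z := by
    rw [hW, hy, Submodule.span_singleton_le_iff_mem]
    exact Submodule.smul_mem _ _ (Submodule.mem_span_singleton_self z)
  have h1 := Module.lengthAt_le_of_surjective (Submodule.factor hle) (Submodule.factor_surjective hle)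
    (primeT p)
  rw [hTW] at h1
  exact le_antisymm h1 bot_le

/-- **Kato's `μ` in the hull currency: `ord_p [A : Λ·ι(ȳ)] − ord_p #(H2/TH2) = e(F/Λz) + e − e(H2)`**,
i.e. `μ = [A : y]·p^{−e}/#(H2/TH2) = p^{e(F/Λz) − e(H2)}` exactly (`#H2[T]` cancels). Needs `H2/TH2`
finite and `[A : Λ·ι(ȳ)] ≠ 0`; no divisibility. [cite: Kato2004Asterisque, Prop. 14.16 (2) and its `μ` (p. 244), Lemma 14.15 (p. 244)] -/
theorem padicValNat_index_eq_of_hull (j : H →ₗ[IwasawaAlgebra p] F)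
    (hj : Function.Injective j) (hcok : Finite (F ⧸ LinearMap.range j)) (z : F) (hz : z ≠ 0)
    (hFZ : Module.IsTorsion (IwasawaAlgebra p) (F ⧸ (IwasawaAlgebra p) ∙ z))
    (hH2 : Module.IsTorsion (IwasawaAlgebra p) H2)
    (y : H) (e : ℕ) (hy : j y = PowerSeries.C ((p : ℤ_[p]) ^ e) • z)
    (ι : coinvariants p H →ₗ[IwasawaAlgebra p] A) (π : A →ₗ[IwasawaAlgebra p] invariants p H2)
    (hι : Function.Injective ι) (hπ : Function.Surjective π) (hex : Function.Exact ι π)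
    (hfin : Finite (coinvariants p H2))
    (hne : Nat.card (A ⧸ (IwasawaAlgebra p) ∙ ι (Submodule.Quotient.mk y)) ≠ 0) :
    (padicValNat p (Nat.card (A ⧸ (IwasawaAlgebra p) ∙ ι (Submodule.Quotient.mk y))) : ℤ) -
        padicValNat p (Nat.card (coinvariants p H2)) =
      (eulerExp p (F ⧸ (IwasawaAlgebra p) ∙ z) : ℤ) + e - eulerExp p H2 := by
  haveI := hfin
  have hA := index_eq_natCard_invariants_mul_pow_of_hull j hj hcok z hz hFZ y e hy ι π hι hπ
    hex hne
  obtain ⟨hfinT, hcard2⟩ := natCard_coinvariants_eq_of_finite H2 hH2 hfin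
  haveI := hfinT
  have hI : Nat.card (invariants p H2) ≠ 0 := (Nat.card_pos (α := invariants p H2)).ne'
  have h1 : padicValNat p (Nat.card (A ⧸ (IwasawaAlgebra p) ∙ ι (Submodule.Quotient.mk y))) =
      padicValNat p (Nat.card (invariants p H2)) + (eulerExp p (F ⧸ (IwasawaAlgebra p) ∙ z) + e) := by
    rw [hA, padicValNat.mul hI (pow_ne_zero _ (Fact.out : p.Prime).ne_zero), padicValNat.prime_pow]
  have h2 : padicValNat p (Nat.card (coinvariants p H2)) =
      padicValNat p (Nat.card (invariants p H2)) + eulerExp p H2 := by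
    rw [hcard2, padicValNat.mul hI (pow_ne_zero _ (Fact.out : p.Prime).ne_zero),
      padicValNat.prime_pow]
  rw [h1, h2]
  push_cast
  ring

/-- **THE DESCENT OF CONJ. 12.10 THROUGH THE HULL: `ℓ_𝔮(H2) = ℓ_𝔮(F/Λz)` at every height-one `𝔮`
⇒ `[A : Λ·ι(ȳ)] = p^e · #(H2/TH2)`**, i.e. `[H¹(ℤ[1/p],T) : z] = #H²(ℤ[1/p],T)` (`μ = 1`) for Kato's
generalized index `[A : z] = [A : y]·p^{−e}` — Kato's §14.14–14.15 with the Main Conjecture, at a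
lattice whose zeta element is only in the reflexive hull of `𝐇¹(T)` (the member of the isogeny class
with rational `p`-torsion: Wuthrich 2014 §3.2–3.4). The characteristic ideal of `F/Λz` is that of
`𝐇¹(T)/Z(T)` up to pseudo-null modules, so the hypothesis IS Conj. 12.10 on this component. Module
theory only; nothing about Kato's objects is asserted.
[cite: Kato2004Asterisque, Conj. 12.10 (p. 224), §14.14 and Lemma 14.15 (pp. 243–244), p. 237] [cite: Wuthrich2014, §3.2 (p. 394)] -/
theorem index_eq_pow_mul_natCard_coinvariants_of_hull_of_lengthAt_eq (j : H →ₗ[IwasawaAlgebra p] F)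
    (hj : Function.Injective j) (hcok : Finite (F ⧸ LinearMap.range j)) (z : F) (hz : z ≠ 0)
    (hFZ : Module.IsTorsion (IwasawaAlgebra p) (F ⧸ (IwasawaAlgebra p) ∙ z))
    (hH2 : Module.IsTorsion (IwasawaAlgebra p) H2)
    (hMC : ∀ 𝔮 : PrimeSpectrum (IwasawaAlgebra p), 𝔮.asIdeal.height = 1 →
      Module.lengthAt (IwasawaAlgebra p) H2 𝔮 =
        Module.lengthAt (IwasawaAlgebra p) (F ⧸ (IwasawaAlgebra p) ∙ z) 𝔮)
    (y : H) (e : ℕ) (hy : j y = PowerSeries.C ((p : ℤ_[p]) ^ e) • z)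
    (ι : coinvariants p H →ₗ[IwasawaAlgebra p] A) (π : A →ₗ[IwasawaAlgebra p] invariants p H2)
    (hι : Function.Injective ι) (hπ : Function.Surjective π) (hex : Function.Exact ι π)
    (hfin : Finite (coinvariants p H2))
    (hne : Nat.card (A ⧸ (IwasawaAlgebra p) ∙ ι (Submodule.Quotient.mk y)) ≠ 0) :
    Nat.card (A ⧸ (IwasawaAlgebra p) ∙ ι (Submodule.Quotient.mk y)) =
      p ^ e * Nat.card (coinvariants p H2) := by
  have hA := index_eq_natCard_invariants_mul_pow_of_hull j hj hcok z hz hFZ y e hy ι π hι hπ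
    hex hne
  obtain ⟨-, hcard2⟩ := natCard_coinvariants_eq_of_finite H2 hH2 hfin
  rw [hA, hcard2, eulerExp_eq_of_lengthAt_eq hMC, pow_add]
  ring

/-- **The converse through the hull: the divisibility `ℓ_𝔮(H2) ≤ ℓ_𝔮(F/Λz)` at every height-one `𝔮`
and `μ = 1` (`[A : Λ·ι(ȳ)] = p^e · #(H2/TH2)`) give `ℓ_𝔮(H2) = ℓ_𝔮(F/Λz)` at EVERY height-one `𝔮`**
(Conj. 12.10 on this component, read on the hull): the exact index gives `e(H2) = e(F/Λz)`, at
`𝔮 = (T)` both lengths vanish (`H2/TH2` and `(F/Λz)/T` are finite), and off `(T)` the termwise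
inequalities with equal weighted sums are equalities. Module theory only.
[cite: Kato2004Asterisque, Thm. 12.5 (3)–(4) (p. 222), Conj. 12.10 (p. 224), §14.14 (p. 243)] [cite: Wuthrich2014, Lemma 14 (p. 396)] -/
theorem lengthAt_eq_of_index_eq_pow_mul_natCard_coinvariants_of_hull (j : H →ₗ[IwasawaAlgebra p] F)
    (hj : Function.Injective j) (hcok : Finite (F ⧸ LinearMap.range j)) (z : F) (hz : z ≠ 0)
    (hFZ : Module.IsTorsion (IwasawaAlgebra p) (F ⧸ (IwasawaAlgebra p) ∙ z))
    (hH2 : Module.IsTorsion (IwasawaAlgebra p) H2)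
    (hdiv : ∀ 𝔮 : PrimeSpectrum (IwasawaAlgebra p), 𝔮.asIdeal.height = 1 →
      Module.lengthAt (IwasawaAlgebra p) H2 𝔮 ≤
        Module.lengthAt (IwasawaAlgebra p) (F ⧸ (IwasawaAlgebra p) ∙ z) 𝔮)
    (y : H) (e : ℕ) (hy : j y = PowerSeries.C ((p : ℤ_[p]) ^ e) • z)
    (ι : coinvariants p H →ₗ[IwasawaAlgebra p] A) (π : A →ₗ[IwasawaAlgebra p] invariants p H2)
    (hι : Function.Injective ι) (hπ : Function.Surjective π) (hex : Function.Exact ι π)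
    (hfin : Finite (coinvariants p H2))
    (hμ : Nat.card (A ⧸ (IwasawaAlgebra p) ∙ ι (Submodule.Quotient.mk y)) =
      p ^ e * Nat.card (coinvariants p H2)) :
    ∀ 𝔮 : PrimeSpectrum (IwasawaAlgebra p), 𝔮.asIdeal.height = 1 →
      Module.lengthAt (IwasawaAlgebra p) H2 𝔮 =
        Module.lengthAt (IwasawaAlgebra p) (F ⧸ (IwasawaAlgebra p) ∙ z) 𝔮 := by
  haveI := hfin
  have h2pos : 0 < Nat.card (coinvariants p H2) := Nat.card_pos
  have hne : Nat.card (A ⧸ (IwasawaAlgebra p) ∙ ι (Submodule.Quotient.mk y)) ≠ 0 := by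
    rw [hμ]; exact (Nat.mul_pos (pow_pos (Fact.out : p.Prime).pos _) h2pos).ne'
  -- the exact index and the count for `H2`
  have hA := index_eq_natCard_invariants_mul_pow_of_hull j hj hcok z hz hFZ y e hy ι π hι hπ
    hex hne
  obtain ⟨hfinT, hcard2⟩ := natCard_coinvariants_eq_of_finite H2 hH2 hfin
  haveI := hfinT
  have hIpos : 0 < Nat.card (invariants p H2) := Nat.card_pos
  -- `e(H2) = e(F/Λz)`
  have hE : eulerExp p H2 = eulerExp p (F ⧸ (IwasawaAlgebra p) ∙ z) := by
    have h : Nat.card (invariants p H2) * p ^ (eulerExp p (F ⧸ (IwasawaAlgebra p) ∙ z) + e) =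
        Nat.card (invariants p H2) * p ^ (eulerExp p H2 + e) := by
      rw [← hA, hμ, hcard2]; ring
    have h' := Nat.eq_of_mul_eq_mul_left hIpos h
    have h'' := Nat.pow_right_injective (Fact.out : p.Prime).two_le h'
    omega
  -- at `(T)` both lengths vanish: `H2/TH2` is finite, and `(F/Λz)` has `ℓ_{(T)} = 0` because
  -- `ℓ_{(T)}(F/Λz) ≤ ℓ_{(T)}(F/Λ j y) = ℓ_{(T)}(H/Λy) + ℓ_{(T)}(finite) = 0` (`(H/Λy)/T` is finite as
  -- `[A : Λ·ι ȳ] ≠ 0`; the cokernel of `H/Λy ↪ F/Λ j y` is a quotient of the finite `F/j(H)`).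
  have hT2 : Module.lengthAt (IwasawaAlgebra p) H2 (primeT p) = 0 :=
    lengthAt_primeT_eq_zero_of_finite_coinvariants H2 hH2 hfin
  have hTF : Module.lengthAt (IwasawaAlgebra p) (F ⧸ (IwasawaAlgebra p) ∙ z) (primeT p) = 0 :=
    lengthAt_primeT_quotient_span_eq_zero_of_hull j hj hcok z hFZ y e hy ι π hι hπ hex hne
  exact lengthAt_eq_of_lengthAt_le_of_eulerExp_eq hH2 hFZ hdiv hE (by rw [hT2, hTF])

end Hull

end Literature.NumberTheory.EllipticCurves.Kato2004

end
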